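import Summits.BirchSwinnertonDyer.BirchSwinnertonDyer.Theorems.ByReductionTypeAtTwoFineSelmerConjAAtTwoAdditivePotGoodChevalleyDoorAtTwo
import Literature.NumberTheory.IwasawaTheory.ClassicalMuVanishesUnitNormIndexGenerated
import Mathlib.NumberTheory.NumberField.Units.DirichletTheorem
import HarnessLib

/-!
# Route `AlignedTransportAtTwo`, crux C2 `MainConjectureOfRankZeroBSDAtTwo` (stmt-BirchSwinnertonDyer-22298):
# THE LAYER-ONE PARITY OBSTRUCTION — Chevalley's ambiguous class number formula at `p = 2` read DOWNWARD: three ramified primes in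
# `K(√2)/K` over a field `K` of odd degree and unit rank `1` (a complex cubic field) force `2 · h_K ∣ h(K(√2))`, i.e. `e₁ ≥ e₀ + 1`

HONEST FRAMING (cell `bsd-f1-sign2`, WIDTH-5 attached prover seat `bsd-line-att-p5` gen 25 on line `birth` of the lead `bsd-line-att-p2`;
`--supports` stmt-BirchSwinnertonDyer-22298, closes nothing; BSD is NOT proved by any of this; the crux C2, its verdict «blocked-on
`Rank1Residual.GreenbergMuConjectureIrreducible`» and every registered stub are untouched). THEOREMS ONLY — no definition, no named fact,
no `sorry`. Pure number-field statements; the sequel `…CubicLayerOneDoors` applies them to the cubic `2`-torsion fields of the seeds.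

WHY. att-p5 g24 (`…CubicCarrierRoad`) reduced C2's `Δ_W < 0` input to H3M⁻ = «`μ₂ = 0` for the cyclotomic `ℤ₂`-extension of the cubic field
`ℚ(e₁)` of every seed», certified per field by cell bsd-2adic's layer-`(0,1)` doors (`AddKatoTwo.classicalMuVanishes_two_of_odd_discr_of_layerOne`:
bits `2 ∤ h(ℚ(e₁))`, `e₁ = 0`; Chevalley's door `AddKatoTwo.classNumberPExp_one_eq_zero_of_nonNorm_unit_two`: `e₁ = 0`, AT MOST TWO primes above
`2`). All twelve certified seeds have `Δ_W ≡ 1 (mod 8)`, i.e. `2` SPLITS COMPLETELY in `ℚ(e₁)`. For such fields this file shows `e₁ ≥ e₀ + 1`: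
* §1 (generic `L/K` Galois of degree `2`, `s ∈ L ∖ K` with `s² = 2`): `neg_one_mem_unitsE_inf_norm` (`−1 = N(1 + s)` is a norm),
  `exists_ringOfIntegers_unit_of_mem` / `unitsIncl_map_mem` (`E_K = E_L ∩ Kˣ` is the image of `𝓞_Kˣ`), `exists_eq_pm_zpow_of_rank_eq_one`
  (Dirichlet: odd degree and unit rank `1` ⟹ every unit is `±ε^n`), **`relIndex_unitsNorm_le_two`** (the unit norm index
  `[E_K : E_K ∩ N Lˣ]` is `1` or `2`), **`classNumber_mul_two_pow_dvd_four_mul_classNumber`** (Lang's Lemma 4.1 — a TREE THEOREM,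
  `AmbiguousClass.ambiguousClassNumberFormula` — read downward: `h_K · 2^t ∣ 4 · h_L` for `L/K` unramified at infinity with index `≤ 2`,
  `t` the number of ramified primes; `#Cl(L)^G ∣ h_L`).
* §2 (the first layer `K₁ = κ.layer 1 = K(√2)` of a cyclotomic `ℤ₂`-extension `κ` of a field `K` of odd degree and unit rank `1`):
  `ramificationIdxIn_layer_one_ne_one` / `le_ncard_ramified_layer_one` (places above `2` of odd index ramify in `K₁`, tree p687770),
  `exists_repr_layer_one` (`K₁ = K ⊕ K√2`), **`two_mul_classNumber_dvd_classNumber_layer_one`** — at least THREE places above `2` of odd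
  index ⟹ `2 · h_K ∣ h(K₁)`; **`classNumberPExp_zero_succ_le_one`** (`e₀ + 1 ≤ e₁`) and **`classNumberPExp_one_ne_zero`** (`e₁ ≠ 0`: the
  bit displayed by every layer-`(0,1)` door is refuted on such `K`).

References: [Lang1990] Ch. 13 §4, Lemma 4.1–4.2 (PDF pp. 203–204); [Gras2003] II.6.2.3, IV.4 (genus theory); [Washington1997] §13.1,
Prop. 13.2, Lemma 13.3; [Fukuda1994] p. 264 (`A_n`, `e_n`); [NeukirchANT1999] Ch. I §2, §7 Thm. (7.4), §9; tree p703318 (Chevalley's door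
at `2`, whose §1–§2 this file mirrors), p687770 (odd-index criterion).
-/

set_option linter.dupNamespace false
set_option autoImplicit false

noncomputable section

open scoped Classical NumberField nonZeroDivisors

namespace Summit.BirchSwinnertonDyer.BirchSwinnertonDyer.Theorems.AlignedTransportAtTwoCubicLayerOneParity

open NumberField IsDedekindDomain
open Literature.NumberTheory.NumberFields Literature.NumberTheory.NumberFields.AmbiguousClass
  Literature.NumberTheory.NumberFields.AmbiguousIdeal
  Literature.NumberTheory.GaloisRepresentations
  Literature.NumberTheory.GaloisRepresentations.Herbrand Literature.NumberTheory.GaloisRepresentations.MinkowskiUnit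
  Literature.NumberTheory.GaloisRepresentations.CyclicNormIndex Literature.NumberTheory.IwasawaTheory
  Literature.NumberTheory.EllipticCurves
  Summit.BirchSwinnertonDyer.BirchSwinnertonDyer.Theorems.AddKatoTwo

/-! ## §1 Chevalley at `p = 2`, downward: `h_K · 2^t ∣ 4 · h_L` for `L = K(√2)` over a field of unit rank `1` -/

section Chevalley

variable {K L : Type} [Field K] [NumberField K] [Field L] [NumberField L] [Algebra K L]

/-- **`−1 = N_{L/K}(1 + √2)` is a norm from `L = K(√2)`.** For `L/K` Galois of degree `2` and `s ∈ L ∖ K` with `s² = 2`, the unit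
`−1 ∈ Lˣ` lies in `E_L ∩ N_G(Lˣ)` (`N(1 + s) = (1 + s)(1 − s) = −1`). [folklore] [cite: Lang1990, Ch. 13 §4, Lemma 4.1] -/
theorem neg_one_mem_unitsE_inf_norm [IsGalois K L] (hdeg : Module.finrank K L = 2) {s : L} (hs2 : s ^ 2 = 2)
    (hsK : ∀ c : K, algebraMap K L c ≠ s) :
    (-1 : Lˣ) ∈ unitsE L ⊓ (⊤ : Subgroup Lˣ).map (Herbrand.norm (L ≃ₐ[K] L)) := by
  haveI : FiniteDimensional K L := Module.Finite.of_restrictScalars_finite ℚ K L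
  -- the generator `σ` and `σ s = -s`
  have hcard : Nat.card (L ≃ₐ[K] L) = 2 := by rw [IsGalois.card_aut_eq_finrank, hdeg]
  haveI : Fact (Nat.Prime 2) := ⟨Nat.prime_two⟩
  haveI : IsCyclic (L ≃ₐ[K] L) := isCyclic_of_prime_card hcard
  obtain ⟨σ, hσ⟩ := IsCyclic.exists_generator (α := L ≃ₐ[K] L)
  have hσ1 : σ ≠ 1 := by
    intro h1
    have : Nat.card (L ≃ₐ[K] L) = 1 := by
      rw [Nat.card_eq_one_iff_exists]
      refine ⟨1, fun g => ?_⟩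
      obtain ⟨k, hk⟩ := Subgroup.mem_zpowers_iff.mp (hσ g)
      rw [← hk, h1, one_zpow]
    omega
  have hσs : σ s = -s := by
    have hsq : (σ s - s) * (σ s + s) = 0 := by
      have : σ s ^ 2 = 2 := by rw [← map_pow, hs2, map_ofNat]
      linear_combination this - hs2
    rcases mul_eq_zero.mp hsq with h0 | h0
    · exfalso
      -- `σ s = s` forces `s ∈ K` (`s` is fixed by all of `Gal(L/K)`)
      have hfix : σ s = s := by linear_combination h0
      have hstab : Subgroup.zpowers σ ≤ MulAction.stabilizer (L ≃ₐ[K] L) s := by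
        rw [Subgroup.zpowers_le, MulAction.mem_stabilizer_iff]
        exact hfix
      have hall : ∀ g : L ≃ₐ[K] L, g s = s := fun g => MulAction.mem_stabilizer_iff.mp (hstab (hσ g))
      obtain ⟨c, hc⟩ := (IsGalois.mem_range_algebraMap_iff_fixed s).mpr hall
      exact hsK c hc
    · linear_combination h0
  have huniv : (Finset.univ : Finset (L ≃ₐ[K] L)) = {1, σ} := by
    symm
    apply Finset.eq_univ_of_card
    rw [Finset.card_pair hσ1.symm, ← Nat.card_eq_fintype_card, hcard]
  -- the unit `1 + s`
  have h1s : (1 : L) + s ≠ 0 := fun h => by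
    have : s = -1 := by linear_combination h
    rw [this] at hs2; norm_num at hs2
  set u : Lˣ := Units.mk0 (1 + s) h1s with hu
  refine Subgroup.mem_inf.mpr ⟨?_, Subgroup.mem_map.mpr ⟨u, Subgroup.mem_top u, ?_⟩⟩
  · -- `-1 ∈ E_L`
    rw [mem_unitsE_iff]
    exact ⟨-1, Units.ext (by simp)⟩
  · apply Units.ext
    rw [Herbrand.norm_apply, huniv, Finset.prod_pair hσ1.symm, Units.val_mul, val_smul, val_smul, AlgEquiv.one_apply,
      hu, Units.val_mk0, map_add, map_one, hσs, Units.val_neg, Units.val_one]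
    linear_combination (-1 : L) * hs2

omit [NumberField K] [NumberField L] in
/-- **A unit of `L` lying in `K` is (the image of) a unit of `𝓞_K`** (`𝓞_K` is integrally closed, and `K → L` reflects integrality).
[folklore] [cite: NeukirchANT1999, Ch. I §2] -/
theorem exists_ringOfIntegers_unit_of_mem {x : Lˣ} (hx : x ∈ unitsE L ⊓ (unitsIncl K L).range) :
    ∃ v : (𝓞 K)ˣ, unitsIncl K L (Units.map (algebraMap (𝓞 K) K : 𝓞 K →* K) v) = x := by
  obtain ⟨hxE, ⟨c, rfl⟩⟩ := hx
  -- `c` and `c⁻¹` are integral over `ℤ`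
  have hint : ∀ {r : Kˣ}, unitsIncl K L r ∈ unitsE L → IsIntegral ℤ (r : K) := by
    intro r hr
    obtain ⟨w, hw⟩ := mem_unitsE_iff.mp hr
    have h1 : IsIntegral ℤ (algebraMap K L (r : K)) := by
      have : algebraMap K L (r : K) = ((w : 𝓞 L) : L) := by
        rw [← coe_unitsIncl, ← hw]
        rfl
      rw [this]
      exact RingOfIntegers.isIntegral_coe _
    exact (isIntegral_algHom_iff (algebraMap K L).toIntAlgHom (algebraMap K L).injective).mp h1
  have hc := hint hxE
  have hc' : IsIntegral ℤ ((c⁻¹ : Kˣ) : K) := by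
    apply hint
    rw [map_inv]
    exact (unitsE L).inv_mem hxE
  set y : 𝓞 K := ⟨(c : K), hc⟩ with hy
  set y' : 𝓞 K := ⟨((c⁻¹ : Kˣ) : K), hc'⟩ with hy'
  have hyy' : y * y' = 1 := Subtype.ext (by
    change (c : K) * ((c⁻¹ : Kˣ) : K) = 1; rw [Units.val_inv_eq_inv_val, mul_inv_cancel₀ c.ne_zero])
  have hunit : IsUnit y := IsUnit.of_mul_eq_one y' hyy'
  refine ⟨hunit.unit, ?_⟩
  apply Units.ext
  rw [coe_unitsIncl, coe_unitsIncl]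
  change algebraMap K L (((hunit.unit : (𝓞 K)ˣ) : 𝓞 K) : K) = algebraMap K L (c : K)
  rw [IsUnit.unit_spec]
  rfl

omit [NumberField K] [NumberField L] in
/-- Conversely, a unit of `𝓞_K` maps into `E_K = E_L ∩ Kˣ` inside `Lˣ`. [folklore] -/
theorem unitsIncl_map_mem (v : (𝓞 K)ˣ) :
    unitsIncl K L (Units.map (algebraMap (𝓞 K) K : 𝓞 K →* K) v) ∈ unitsE L ⊓ (unitsIncl K L).range := by
  refine ⟨?_, ⟨_, rfl⟩⟩
  haveI : IsScalarTower (𝓞 K) (𝓞 L) L := IsScalarTower.of_algebraMap_eq fun x => rfl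
  refine ⟨Units.map (algebraMap (𝓞 K) (𝓞 L)).toMonoidHom v, Units.ext ?_⟩
  change algebraMap (𝓞 L) L (algebraMap (𝓞 K) (𝓞 L) (v : 𝓞 K)) = algebraMap K L (((v : 𝓞 K) : K))
  rw [← IsScalarTower.algebraMap_apply, IsScalarTower.algebraMap_apply (𝓞 K) K L]

/-- **Every unit of a number field of ODD degree and unit rank `1` is `± ε^n`** (`ε` a fundamental unit; the roots of unity of `K` are
`±1` since `K` has a real place). Dirichlet's unit theorem (Mathlib `NumberField.Units.exist_unique_eq_mul_prod`,
`torsion_eq_one_or_neg_one_of_odd_finrank`). [cite: NeukirchANT1999, Ch. I §7, Thm. (7.4)] -/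
theorem exists_eq_pm_zpow_of_rank_eq_one (hK2 : Odd (Module.finrank ℚ K)) (hrank : Units.rank K = 1) :
    ∃ ε : (𝓞 K)ˣ, ∀ x : (𝓞 K)ˣ, ∃ n : ℤ, x = ε ^ n ∨ x = -ε ^ n := by
  set i₀ : Fin (Units.rank K) := ⟨0, by omega⟩ with hi₀
  haveI : Unique (Fin (Units.rank K)) := ⟨⟨i₀⟩, fun i => Fin.ext (by have := i.2; omega)⟩
  refine ⟨Units.fundSystem K default, fun x => ?_⟩
  obtain ⟨⟨ζ, e⟩, hx, -⟩ := Units.exist_unique_eq_mul_prod K x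
  refine ⟨e default, ?_⟩
  rw [Fintype.prod_unique (fun i => Units.fundSystem K i ^ e i)] at hx
  change x = (ζ : (𝓞 K)ˣ) * Units.fundSystem K default ^ e default at hx
  rcases Units.torsion_eq_one_or_neg_one_of_odd_finrank hK2 ζ with h1 | h1
  · left; rw [hx, h1, one_mul]
  · right; rw [hx, h1, neg_one_mul]

/-- **The unit norm index of `K(√2)/K` is `1` or `2` when `K` has odd degree and unit rank `1`** (e.g. a complex cubic field):
`E_K = ±ε^ℤ`, `−1 = N(1 + √2)` and `ε² = N(ε)` are norms, so `E_K ∩ N Lˣ ⊇ ⟨−1, ε²⟩` has index `≤ 2` in `E_K`.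
[cite: Lang1990, Ch. 13 §4, Lemma 4.1 and proof of Lemma 4.2] [cite: Gras2003, II.6.2.3] -/
theorem relIndex_unitsNorm_le_two [IsGalois K L] (hdeg : Module.finrank K L = 2) {s : L} (hs2 : s ^ 2 = 2)
    (hsK : ∀ c : K, algebraMap K L c ≠ s) (hK2 : Odd (Module.finrank ℚ K)) (hrank : Units.rank K = 1) :
    (unitsE L ⊓ (⊤ : Subgroup Lˣ).map (Herbrand.norm (L ≃ₐ[K] L))).relIndex (unitsE L ⊓ (unitsIncl K L).range) = 1 ∨
    (unitsE L ⊓ (⊤ : Subgroup Lˣ).map (Herbrand.norm (L ≃ₐ[K] L))).relIndex (unitsE L ⊓ (unitsIncl K L).range) = 2 := by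
  haveI : FiniteDimensional K L := Module.Finite.of_restrictScalars_finite ℚ K L
  set A := unitsE L ⊓ (⊤ : Subgroup Lˣ).map (Herbrand.norm (L ≃ₐ[K] L)) with hA
  set B := unitsE L ⊓ (unitsIncl K L).range with hB
  -- squares of elements of `E_K` are norms
  have hsq : ∀ b ∈ B, b ^ 2 ∈ A := fun b hb =>
    ⟨(unitsE L).pow_mem hb.1 2, hdeg ▸ pow_finrank_mem_map_norm hb.2⟩
  have hneg : (-1 : Lˣ) ∈ A := neg_one_mem_unitsE_inf_norm hdeg hs2 hsK
  -- the fundamental unit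
  obtain ⟨ε, hε⟩ := exists_eq_pm_zpow_of_rank_eq_one hK2 hrank
  set ι : (𝓞 K)ˣ →* Lˣ := (unitsIncl K L).comp (Units.map (algebraMap (𝓞 K) K : 𝓞 K →* K)) with hι
  have hιmem : ∀ v : (𝓞 K)ˣ, ι v ∈ B := fun v => unitsIncl_map_mem v
  have hιneg : ι (-1) = -1 := Units.ext (by rw [hι, MonoidHom.comp_apply, coe_unitsIncl]; simp)
  -- every element of `B` is in `A` or in `ι ε · A`
  have key : ∀ b ∈ B, b ∈ A ∨ b * (ι ε)⁻¹ ∈ A := by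
    intro b hb
    obtain ⟨v, hv⟩ := exists_ringOfIntegers_unit_of_mem hb
    have hv' : ι v = b := hv
    obtain ⟨n, hn⟩ := hε v
    -- `v = ± ε^n`; split `n = 2m` or `n = 2m + 1`
    have hpm : ∃ t : Lˣ, t ∈ A ∧ b = t * ι ε ^ n := by
      rcases hn with h | h
      · exact ⟨1, A.one_mem, by rw [← hv', h, map_zpow, one_mul]⟩
      · exact ⟨-1, hneg, by rw [← hv', h, ← neg_one_mul, map_mul, map_zpow, hιneg]⟩
    obtain ⟨t, htA, hbt⟩ := hpm
    obtain ⟨m, hm | hm⟩ := Int.even_or_odd' n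
    · left
      have h2 : ι ε ^ n = (ι ε ^ m) ^ 2 := by rw [hm, ← zpow_natCast, ← zpow_mul, mul_comm]; norm_num
      have hmB : ι ε ^ m ∈ B := B.zpow_mem (hιmem ε) m
      rw [hbt, h2]
      exact A.mul_mem htA (hsq _ hmB)
    · right
      have h2 : ι ε ^ n * (ι ε)⁻¹ = (ι ε ^ m) ^ 2 := by
        rw [hm, zpow_add_one, mul_inv_cancel_right, ← zpow_natCast, ← zpow_mul, mul_comm]; norm_num
      have hmB : ι ε ^ m ∈ B := B.zpow_mem (hιmem ε) m
      rw [hbt, mul_assoc, h2]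
      exact A.mul_mem htA (hsq _ hmB)
  -- hence the quotient `B / (A ⊓ B)` has at most two elements
  set H : Subgroup B := A.subgroupOf B with hH
  let e0 : B := ⟨ι ε, hιmem ε⟩
  let φ : Bool → B ⧸ H := fun c => cond c 1 (QuotientGroup.mk e0)
  have hφ : Function.Surjective φ := by
    intro q
    obtain ⟨y, rfl⟩ := QuotientGroup.mk_surjective q
    rcases key y y.2 with h | h
    · refine ⟨true, ?_⟩
      change (1 : B ⧸ H) = QuotientGroup.mk y
      symm
      rw [QuotientGroup.eq_one_iff, hH, Subgroup.mem_subgroupOf]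
      exact h
    · refine ⟨false, ?_⟩
      change (QuotientGroup.mk e0 : B ⧸ H) = QuotientGroup.mk y
      symm
      rw [QuotientGroup.eq, hH, Subgroup.mem_subgroupOf]
      have : ((y⁻¹ * e0 : B) : Lˣ) = ((y : Lˣ) * (ι ε)⁻¹)⁻¹ := by
        rw [Subgroup.coe_mul, Subgroup.coe_inv, mul_inv_rev, inv_inv, mul_comm]
      rw [this]
      exact A.inv_mem h
  haveI : Finite (B ⧸ H) := Finite.of_surjective φ hφ
  have hle : Nat.card (B ⧸ H) ≤ 2 := by simpa using Nat.card_le_card_of_surjective φ hφ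
  have hpos : 0 < Nat.card (B ⧸ H) := Nat.card_pos
  have hidx : A.relIndex B = Nat.card (B ⧸ H) := rfl
  rw [hidx]
  omega

/-- **Chevalley at `p = 2`, downward: `h_K · 2^t ∣ 4 · h_L`.** Let `L/K` be Galois of degree `2`, unramified at the infinite places,
with unit norm index `[E_K : E_K ∩ N Lˣ] ∈ {1, 2}` and `t` primes of `K` ramified in `L`. Lang's Lemma 4.1 reads
`#Cl(L)^G · 2 · [E_K : E_K ∩ N Lˣ] = h_K · 2^t`; as `#Cl(L)^G ∣ h_L` (the ambiguous classes form a subgroup), `h_K · 2^t ∣ 4 · h_L`.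
[cite: Lang1990, Ch. 13 §4, Lemma 4.1 (PDF p. 203)] [cite: Gras2003, II.6.2.3] -/
theorem classNumber_mul_two_pow_dvd_four_mul_classNumber [IsGalois K L] [IsUnramifiedAtInfinitePlaces K L]
    (hdeg : Module.finrank K L = 2)
    (hI : (unitsE L ⊓ (⊤ : Subgroup Lˣ).map (Herbrand.norm (L ≃ₐ[K] L))).relIndex (unitsE L ⊓ (unitsIncl K L).range) = 1 ∨
      (unitsE L ⊓ (⊤ : Subgroup Lˣ).map (Herbrand.norm (L ≃ₐ[K] L))).relIndex (unitsE L ⊓ (unitsIncl K L).range) = 2) :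
    classNumber K * 2 ^ {v : HeightOneSpectrum (𝓞 K) | v.asIdeal.ramificationIdxIn (𝓞 L) ≠ 1}.ncard ∣ 4 * classNumber L := by
  classical
  haveI : FiniteDimensional K L := Module.Finite.of_restrictScalars_finite ℚ K L
  have hcard : Nat.card (L ≃ₐ[K] L) = 2 := by rw [IsGalois.card_aut_eq_finrank, hdeg]
  haveI : Fact (Nat.Prime 2) := ⟨Nat.prime_two⟩
  haveI : IsCyclic (L ≃ₐ[K] L) := isCyclic_of_prime_card hcard
  obtain ⟨σ, hσ⟩ := IsCyclic.exists_generator (α := L ≃ₐ[K] L)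
  have h := ambiguousClassNumberFormula hσ
  rw [archFactor_eq_one, mul_one, finprod_ramificationIdxIn_eq_pow_of_prime Nat.prime_two hdeg, hdeg] at h
  set t := {v : HeightOneSpectrum (𝓞 K) | v.asIdeal.ramificationIdxIn (𝓞 L) ≠ 1}.ncard with htdef
  set F := Nat.card {c : ClassGroup (𝓞 L) // ∀ τ : L ≃ₐ[K] L, ClassGroup.mulEquiv (intAut τ) c = c} with hF
  have hFdvd : F ∣ classNumber L := card_fixed_dvd_classNumber (K := K) (L := L)
  -- `h_K · 2^t = F · 2 · I ∣ 4 F ∣ 4 h_L`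
  rw [← h]
  rcases hI with hI | hI <;> rw [hI] <;> obtain ⟨c, hc⟩ := hFdvd
  · exact ⟨2 * c, by rw [hc]; ring⟩
  · exact ⟨c, by rw [hc]; ring⟩

end Chevalley

/-! ## §2 The first layer `K₁ = K(√2)` of the cyclotomic `ℤ₂`-extension: `2 · h_K ∣ h(K₁)`, so `e₁ ≥ e₀ + 1 ≥ 1` -/

section LayerOne

variable {K : Type} [Field K] [NumberField K]

/-- **A place above `2` of ODD absolute index ramifies in `K₁`, in the `ramificationIdxIn` currency of Chevalley's formula**: for `K` of
odd degree, a cyclotomic `ℤ₂`-extension `κ` and `w ∣ 2` with `e(w|2)` odd, `e(w, K₁/K) ≠ 1` (`√2 ∈ K₁` makes every index above `2`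
even, tree `not_isUnramifiedIn_layer_one_of_odd_ramificationIdx`; in the Galois extension `K₁/K` the index does not depend on the
prime above). [cite: Washington1997, §13.1] [cite: NeukirchANT1999, Ch. I §8 and §9] -/
theorem ramificationIdxIn_layer_one_ne_one (hK2 : ¬ 2 ∣ Module.finrank ℚ K) (κ : ZpExtension K 2) (hκ : κ.IsCyclotomic)
    {w : HeightOneSpectrum (𝓞 K)} (hw : ((2 : ℕ) : 𝓞 K) ∈ w.asIdeal) (hodd : Odd (w.asIdeal.ramificationIdx ℤ)) :
    haveI : FiniteDimensional K (κ.layer 1) := κ.finiteDimensional_layer_holds 1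
    w.asIdeal.ramificationIdxIn (𝓞 (κ.layer 1)) ≠ 1 := by
  haveI : FiniteDimensional K (κ.layer 1) := κ.finiteDimensional_layer_holds 1
  haveI : IsGalois K (κ.layer 1) := κ.isGalois_layer_holds 1
  haveI : NumberField (κ.layer 1) := NumberField.of_module_finite K (κ.layer 1)
  intro h1
  apply not_isUnramifiedIn_layer_one_of_odd_ramificationIdx hK2 κ hκ hw hodd
  rw [Algebra.isUnramifiedIn_iff_forall_ramificationIdx_eq_one]
  intro P hP hPover
  haveI : w.asIdeal.IsPrime := w.isPrime
  rw [← Ideal.ramificationIdxIn_eq_ramificationIdx w.asIdeal P (κ.layer 1 ≃ₐ[K] κ.layer 1)]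
  exact h1

/-- **At least `m` places above `2` of odd index ⟹ at least `m` primes ramify in `K₁/K`** (`K` of odd degree, `κ` cyclotomic).
[cite: Washington1997, §13.1] -/
theorem le_ncard_ramified_layer_one (hK2 : ¬ 2 ∣ Module.finrank ℚ K) (κ : ZpExtension K 2) (hκ : κ.IsCyclotomic) {m : ℕ}
    (hm : m ≤ {w : HeightOneSpectrum (𝓞 K) | ((2 : ℕ) : 𝓞 K) ∈ w.asIdeal ∧ Odd (w.asIdeal.ramificationIdx ℤ)}.ncard) :
    haveI : FiniteDimensional K (κ.layer 1) := κ.finiteDimensional_layer_holds 1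
    m ≤ {v : HeightOneSpectrum (𝓞 K) | v.asIdeal.ramificationIdxIn (𝓞 (κ.layer 1)) ≠ 1}.ncard := by
  haveI : FiniteDimensional K (κ.layer 1) := κ.finiteDimensional_layer_holds 1
  haveI : IsGalois K (κ.layer 1) := κ.isGalois_layer_holds 1
  haveI : NumberField (κ.layer 1) := NumberField.of_module_finite K (κ.layer 1)
  refine hm.trans (Set.ncard_le_ncard (fun w hw => ?_) (finite_setOf_ramificationIdxIn_ne_one (K := K) (L := κ.layer 1)))
  exact ramificationIdxIn_layer_one_ne_one hK2 κ hκ hw.1 hw.2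

/-- `K₁ = K ⊕ K·s` for an element `s ∈ K₁ ∖ K` of the quadratic layer (a `K`-basis `{1, s}`). [folklore] -/
theorem exists_repr_layer_one (κ : ZpExtension K 2) {s : κ.layer 1} (hsK : ∀ c : K, algebraMap K (κ.layer 1) c ≠ s)
    (x : κ.layer 1) : ∃ a b : K, x = algebraMap K (κ.layer 1) a + algebraMap K (κ.layer 1) b * s := by
  haveI : FiniteDimensional K (κ.layer 1) := κ.finiteDimensional_layer_holds 1
  have hdeg : Module.finrank K (κ.layer 1) = 2 := by rw [κ.finrank_layer_holds 1, pow_one]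
  have hli : LinearIndependent K ![(1 : κ.layer 1), s] := by
    refine LinearIndependent.pair_iff.mpr fun a b hab => ?_
    by_cases hb : b = 0
    · subst hb
      simp only [zero_smul, add_zero, smul_eq_zero, one_ne_zero, or_false] at hab
      exact ⟨hab, rfl⟩
    · exfalso
      apply hsK (-(a / b))
      rw [Algebra.smul_def, Algebra.smul_def, mul_one] at hab
      have hb' : algebraMap K (κ.layer 1) b ≠ 0 := by rwa [Ne, map_eq_zero]
      rw [map_neg, map_div₀, ← neg_div, div_eq_iff hb']
      linear_combination (-1 : κ.layer 1) * hab
  let B : Module.Basis (Fin 2) K (κ.layer 1) := basisOfLinearIndependentOfCardEqFinrank hli (by simp [hdeg])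
  have hB : ∀ i, B i = ![(1 : κ.layer 1), s] i := fun i => by simp [B, coe_basisOfLinearIndependentOfCardEqFinrank]
  refine ⟨B.repr x 0, B.repr x 1, ?_⟩
  conv_lhs => rw [← B.sum_repr x]
  rw [Fin.sum_univ_two, hB, hB, Algebra.smul_def, Algebra.smul_def]
  simp

/-- **`2 · h_K ∣ h(K₁)`: THE LAYER-ONE PARITY OBSTRUCTION.** Let `K` be a number field of ODD degree and unit rank `1` (e.g. a complex cubic
field), `κ` a cyclotomic `ℤ₂`-extension of `K` (first layer `K₁ = K(√2)`), and suppose AT LEAST THREE places of `K` above `2` have odd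
ramification index over `ℤ` (e.g. `2` splits completely in `K`). Then `2 · h_K ∣ h(K₁)`. (Chevalley: `#Cl(K₁)^G · 2 · [E_K : E_K ∩ N K₁ˣ]
= h_K · 2^t` with `t ≥ 3`, `e_∞ = 1` as `√2` is real, `[E_K : E_K ∩ N K₁ˣ] ≤ 2` by §1.) [cite: Lang1990, Ch. 13 §4, Lemma 4.1 (PDF p. 203)]
[cite: Gras2003, II.6.2.3 (genus theory)] [cite: Washington1997, §13.1] -/
theorem two_mul_classNumber_dvd_classNumber_layer_one (hK2 : ¬ 2 ∣ Module.finrank ℚ K) (hrank : Units.rank K = 1)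
    (κ : ZpExtension K 2) (hκ : κ.IsCyclotomic)
    (h3 : 3 ≤ {w : HeightOneSpectrum (𝓞 K) | ((2 : ℕ) : 𝓞 K) ∈ w.asIdeal ∧ Odd (w.asIdeal.ramificationIdx ℤ)}.ncard) :
    haveI : FiniteDimensional K (κ.layer 1) := κ.finiteDimensional_layer_holds 1
    haveI : NumberField (κ.layer 1) := NumberField.of_module_finite K (κ.layer 1)
    2 * classNumber K ∣ classNumber (κ.layer 1) := by
  haveI : FiniteDimensional K (κ.layer 1) := κ.finiteDimensional_layer_holds 1
  haveI : IsGalois K (κ.layer 1) := κ.isGalois_layer_holds 1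
  haveI : NumberField (κ.layer 1) := NumberField.of_module_finite K (κ.layer 1)
  have hdeg : Module.finrank K (κ.layer 1) = 2 := by rw [κ.finrank_layer_holds 1, pow_one]
  obtain ⟨s, hs2⟩ := exists_sq_eq_two_layer_one_of_not_dvd_finrank hK2 κ hκ
  -- `s ∉ K`, `K₁ = K ⊕ K s`, unramified at infinity
  have hsK : ∀ c : K, algebraMap K (κ.layer 1) c ≠ s := by
    intro c hc
    apply sq_ne_two_of_odd_finrank hK2 c
    apply (algebraMap K (κ.layer 1)).injective
    rw [map_pow, hc, hs2, map_ofNat]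
  haveI : IsUnramifiedAtInfinitePlaces K (κ.layer 1) :=
    isUnramifiedAtInfinitePlaces_of_sq_eq_two hs2 (exists_repr_layer_one κ hsK)
  have hodd : Odd (Module.finrank ℚ K) := Nat.odd_iff.mpr (Nat.two_dvd_ne_zero.mp hK2)
  have hI := relIndex_unitsNorm_le_two hdeg hs2 hsK hodd hrank
  have hdvd := classNumber_mul_two_pow_dvd_four_mul_classNumber hdeg hI
  have ht := le_ncard_ramified_layer_one hK2 κ hκ h3
  obtain ⟨d, hd⟩ := Nat.exists_eq_add_of_le ht
  rw [hd, pow_add] at hdvd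
  obtain ⟨c, hc⟩ := hdvd
  refine ⟨2 ^ d * c, Nat.eq_of_mul_eq_mul_left (by norm_num : 0 < 4) ?_⟩
  rw [hc]; ring

/-- **`e₁ ≥ e₀ + 1`** (valuation form): under the hypotheses of `two_mul_classNumber_dvd_classNumber_layer_one`,
`ord₂ h(K) + 1 ≤ ord₂ h(K₁)`, i.e. `classNumberPExp κ 0 + 1 ≤ classNumberPExp κ 1`. [cite: Lang1990, Ch. 13 §4, Lemma 4.1]
[cite: Fukuda1994, p. 264 (notation `A_n`, `e_n`)] -/
theorem classNumberPExp_zero_succ_le_one (hK2 : ¬ 2 ∣ Module.finrank ℚ K) (hrank : Units.rank K = 1)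
    (κ : ZpExtension K 2) (hκ : κ.IsCyclotomic)
    (h3 : 3 ≤ {w : HeightOneSpectrum (𝓞 K) | ((2 : ℕ) : 𝓞 K) ∈ w.asIdeal ∧ Odd (w.asIdeal.ramificationIdx ℤ)}.ncard) :
    classNumberPExp κ 0 + 1 ≤ classNumberPExp κ 1 := by
  haveI : FiniteDimensional K (κ.layer 1) := κ.finiteDimensional_layer_holds 1
  haveI : NumberField (κ.layer 1) := NumberField.of_module_finite K (κ.layer 1)
  haveI : Fact (Nat.Prime 2) := ⟨Nat.prime_two⟩
  have hdvd := two_mul_classNumber_dvd_classNumber_layer_one hK2 hrank κ hκ h3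
  rw [classNumberPExp_zero_eq_padicValNat_classNumber, classNumberPExp_eq_padicValNat_classNumber]
  refine (padicValNat_dvd_iff_le (classNumber_ne_zero (κ.layer 1))).mp ?_
  rw [pow_succ]
  exact (mul_dvd_mul pow_padicValNat_dvd (dvd_refl 2)).trans (by rw [mul_comm]; exact hdvd)

/-- **`e₁ ≠ 0`: the class number of `K₁ = K(√2)` is EVEN** — so NO layer-`(0, 1)` certificate of the tree's two-layer doors
(`AddKatoTwo.classicalMuVanishes_two_of_odd_discr_of_layerOne`, Chevalley's door `AddKatoTwo.classNumberPExp_one_eq_zero_of_nonNorm_unit_two`,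
whose conclusion / displayed bit is `classNumberPExp κ 1 = 0`) exists for such `K`. [cite: Lang1990, Ch. 13 §4, Lemma 4.1]
[cite: Fukuda1994, Thm. 1 (1), p. 264] -/
theorem classNumberPExp_one_ne_zero (hK2 : ¬ 2 ∣ Module.finrank ℚ K) (hrank : Units.rank K = 1)
    (κ : ZpExtension K 2) (hκ : κ.IsCyclotomic)
    (h3 : 3 ≤ {w : HeightOneSpectrum (𝓞 K) | ((2 : ℕ) : 𝓞 K) ∈ w.asIdeal ∧ Odd (w.asIdeal.ramificationIdx ℤ)}.ncard) :
    classNumberPExp κ 1 ≠ 0 := by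
  have := classNumberPExp_zero_succ_le_one hK2 hrank κ hκ h3
  omega

end LayerOne

end Summit.BirchSwinnertonDyer.BirchSwinnertonDyer.Theorems.AlignedTransportAtTwoCubicLayerOneParity

end
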